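import Summits.BirchSwinnertonDyer.BirchSwinnertonDyer.Theorems.EisensteinDepletionAtTwoStarPrimeLevelModels
import Literature.NumberTheory.EllipticCurves.GlobalMinimalModel
import Literature.NumberTheory.EllipticCurves.LambdaInvariantCongruenceTransportAtTwo
import Literature.NumberTheory.EllipticCurves.PAdicLFunction
import HarnessLib

/-!
# Route `EisensteinDepletionAtTwo`, crux E1M `DepletedLambdaLawAtTwoMod` (item stmt-BirchSwinnertonDyer-20341),
# line `star` — prime-level content of the research stub (★-SymbC), part 2: THE HABITAT IS EMPTY AT PRIME CONDUCTOR

Cell `bsd-rank2` (HOME run/shared/lean/pub/bsd-rank2/), seat `bsd-rank2-eng-2` GEN 9. THEOREMS ONLY — no definition,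
no new named fact, no `sorry`. HONEST FRAMING: elementary algebra of Weierstrass models over ONE published
classification carried by the tree as a named fact (`Setzer1975_primeConductor_rationalTwoTorsion`, lit GEN 21,
`Literature/…/NeumannSetzerCurves.lean`); nothing reads an analytic rank; (★-SymbC)/(★)/E1M are NOT proved; BSD is not
proved by any of this (PARTITION D-0054: none — r_an ≥ 2 axis S0, door T-r3₂).

WHAT IS PROVED. The registered research stub `stub_starSymbC : StarSymbC` of the skeleton
`Cruxes/DepletedLambdaLawAtTwoMod/Lines/star.lean` (v3.1) concludes, for every globally minimal `W/ℚ` good ordinary at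
`2` carrying a UNIQUE rational `2`-torsion point of Greenberg type A xor B (Prop. 5.14 habitat), that SOME admissible
stabilisation datum `β` at level `N_W` exists (with a mod-`2` congruence on `C`). Planner p2 GEN 21 flagged the hidden
content (H1) of this typing (memo `p2/g21/serre-dlog.md` §4, re-cut §5 `stub_P`): at PRIME level no admissible datum
exists (`not_isAdmissibleStabData_of_prime`, part 1), so there the stub asserts that the Prop-5.14 habitat is EMPTY.
Here:

* §4 NO globally minimal curve `ℚ`-isomorphic to a Neumann–Setzer curve carries a rational `2`-torsion point that is
  «ramified at `2` and not odd, or odd and not ramified at `2`» — on `E₁(u)` the point is `(0,0)`: `x ∈ ℤ` (not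
  ramified) and the middle root (not odd); on `E₀(u)` it is `(u/4, −u/8)`: `v₂(x) = −2` (ramified) and the only real
  root (odd) — fact-free given the model (`not_prop514_of_smul_eq_neumannSetzerCurve₀/₁`); and, modulo Setzer's
  classification, no curve of PRIME conductor `≠ 17` does (`not_prop514_of_prime_conductor`);
* §5 the generic reduction for the lead: any statement with the binders and hypotheses of `StarSymbC` (`W, x`,
  `IsOrdinaryAt W 2`, `HasUniqueRationalTwoTorsionX W x`, type A xor B; ARBITRARY conclusion `Concl W x`) follows from
  its restriction to conductors that are NOT prime or are equal to `17`, plus Setzer (`of_restrict_offPrime`); and it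
  HOLDS outright at prime conductor `≠ 17` (`starSymbC_shape_of_prime_conductor`). The level `17` (four curves
  17a1–a4; p2 GEN 21 (H1) records AB / full `2`-torsion / AB / MID by inspection) is left to a Cremona-table fact and
  is not asserted here.

References: B. Setzer, J. London Math. Soc. (2) 10 (1975) 367–378 [Setzer1975]; W. Stein, M. Watkins, IMRN 2004:27
[SteinWatkins2004, §1]; B. Mazur, Publ. Math. IHÉS 47 (1977), III §7 [Mazur1977]; R. Greenberg, LNM 1716 (1999) §5,
Prop. 5.14 [GreenbergLNM1716]; J. Silverman, GTM 106, III.1, VII.1 [SilvermanAEC2009].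
-/

set_option linter.dupNamespace false
set_option autoImplicit false

noncomputable section

open scoped Classical

open WeierstrassCurve Literature.NumberTheory.EllipticCurves Literature.NumberTheory.EllipticCurves.Greenberg1999

namespace Summit.BirchSwinnertonDyer.BirchSwinnertonDyer.Theorems.DepletionAtTwo

/-! ## §4 The Prop-5.14 habitat is empty at Neumann–Setzer levels and at prime conductor `≠ 17` -/

section Habitat

variable (W : WeierstrassCurve ℚ) [W.IsElliptic] [W.IsGloballyMinimal]

/-- For a change of variables between two GLOBAL MINIMAL models over `ℚ`: `u = ±1` and `r ∈ ℤ` (the part of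
`WeierstrassCurve.isGloballyMinimal_unique_holds` used below). [cite: SilvermanAEC2009, VII.1.3(b) and VIII.8.3] -/
theorem sq_u_eq_one_and_r_int (C : VariableChange ℚ) [(C • W).IsGloballyMinimal] :
    (C.u : ℚ) ^ 2 = 1 ∧ ∃ r : ℤ, C.r = r := by
  obtain ⟨hu, r, s, t, hr, -, -⟩ := WeierstrassCurve.isGloballyMinimal_unique_holds W C
  refine ⟨?_, r, hr⟩
  rcases hu with h | h <;> simp [h]

/-- **No Prop-5.14 point on a curve with the Neumann–Setzer model `E₁(u)`** (`u² + 64` prime, `u ≡ 3 (mod 4)`): its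
rational `2`-torsion point corresponds to `(0,0)`, which is neither ramified at `2` (`x ∈ ℤ`) nor odd (middle root).
[cite: GreenbergLNM1716, Prop. 5.14 (chunk p0170)] [cite: SteinWatkins2004, §1 (PDF p. 3)] -/
theorem not_prop514_of_smul_eq_neumannSetzerCurve₁ {u : ℤ} {N : ℕ} (hN : N.Prime) (hNu : (N : ℤ) = u ^ 2 + 64)
    (hu4 : u % 4 = 3) (C : VariableChange ℚ) (hC : C • W = neumannSetzerCurve₁ u) {x : ℚ}
    (hx : HasRationalTwoTorsionX W x) :
    ¬ ((TwoTorsionRamifiedAtTwo x ∧ ¬ TwoTorsionOdd W x) ∨ (TwoTorsionOdd W x ∧ ¬ TwoTorsionRamifiedAtTwo x)) := by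
  haveI : (C • W).IsGloballyMinimal := by
    rw [hC]; exact isGloballyMinimal_neumannSetzerCurve₁ u hN hNu hu4
  obtain ⟨hu2, r, hr⟩ := sq_u_eq_one_and_r_int W C
  -- the transported point is `(0, 0)`
  have hx' : HasRationalTwoTorsionX (neumannSetzerCurve₁ u) (C.toX x) := hC ▸ hasRationalTwoTorsionX_smul W C hx
  have h0 : C.toX x = 0 := eq_zero_of_hasRationalTwoTorsionX_neumannSetzerCurve₁ u hN hNu hx'
  have hxr : x = r := by rw [eq_ofX_toX C x, h0, mul_zero, zero_add, hr]
  -- not ramified: `x ∈ ℤ`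
  have hnram : ¬ TwoTorsionRamifiedAtTwo x := by
    rw [twoTorsionRamifiedAtTwo_iff, hxr, padicValRat.of_int, not_lt]
    exact Int.natCast_nonneg _
  -- not odd: transported, `(0,0)` is the middle root
  have hnodd : ¬ TwoTorsionOdd W x := by
    intro h
    have h' := (twoTorsionOdd_smul_iff W C x).mpr h
    rw [hC, h0] at h'
    exact not_twoTorsionOdd_neumannSetzerCurve₁ u h'
  rintro (⟨hram, -⟩ | ⟨hodd, -⟩)
  · exact hnram hram
  · exact hnodd hodd

/-- **No Prop-5.14 point on a curve with the Neumann–Setzer model `E₀(u)`** (`u² + 64` prime, `u ≡ 3 (mod 4)`): its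
rational `2`-torsion point corresponds to `(u/4, −u/8)`, which is BOTH ramified at `2` (`v₂(u/4 + r) = −2`) and odd
(only real root). [cite: GreenbergLNM1716, Prop. 5.14 (chunk p0170)] [cite: SteinWatkins2004, §1 (PDF p. 3)] -/
theorem not_prop514_of_smul_eq_neumannSetzerCurve₀ {u : ℤ} {N : ℕ} (hN : N.Prime) (hNu : (N : ℤ) = u ^ 2 + 64)
    (hu4 : u % 4 = 3) (C : VariableChange ℚ) (hC : C • W = neumannSetzerCurve₀ u) {x : ℚ}
    (hx : HasRationalTwoTorsionX W x) :
    ¬ ((TwoTorsionRamifiedAtTwo x ∧ ¬ TwoTorsionOdd W x) ∨ (TwoTorsionOdd W x ∧ ¬ TwoTorsionRamifiedAtTwo x)) := by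
  haveI : (C • W).IsGloballyMinimal := by
    rw [hC]; exact isGloballyMinimal_neumannSetzerCurve₀ u hN hNu hu4
  obtain ⟨hu2, r, hr⟩ := sq_u_eq_one_and_r_int W C
  have hx' : HasRationalTwoTorsionX (neumannSetzerCurve₀ u) (C.toX x) := hC ▸ hasRationalTwoTorsionX_smul W C hx
  have h4 : C.toX x = (u : ℚ) / 4 := eq_of_hasRationalTwoTorsionX_neumannSetzerCurve₀ u hx'
  have hxr : x = ((u + 4 * r : ℤ) : ℚ) / 4 := by
    rw [eq_ofX_toX C x, h4, hu2, hr]; push_cast; ring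
  -- ramified: `v₂((u + 4r)/4) = −2` (`u` odd)
  have hodd_u : Odd u := odd_of_prime_sq_add_sixty_four hN hNu
  have hram : TwoTorsionRamifiedAtTwo x := by
    have hodd' : Odd (u + 4 * r) := by
      rcases hodd_u with ⟨k, hk⟩; exact ⟨k + 2 * r, by rw [hk]; ring⟩
    have hne_int : u + 4 * r ≠ 0 := by
      rintro h0; rw [h0] at hodd'; exact (by decide : ¬ Odd (0 : ℤ)) hodd'
    have hne : ((u + 4 * r : ℤ) : ℚ) ≠ 0 := by exact_mod_cast hne_int
    have h0 : padicValInt 2 (u + 4 * r) = 0 := by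
      refine padicValInt.eq_zero_of_not_dvd fun h2 ↦ ?_
      have h2' : (2 : ℤ) ∣ u + 4 * r := by exact_mod_cast h2
      exact (Int.not_even_iff_odd.mpr hodd') (even_iff_two_dvd.mpr h2')
    have h4 : padicValRat 2 (4 : ℚ) = 2 := by
      rw [show (4 : ℚ) = ((2 ^ 2 : ℕ) : ℚ) by norm_num, padicValRat.of_nat, padicValNat.prime_pow]
      rfl
    rw [twoTorsionRamifiedAtTwo_iff, hxr, padicValRat.div hne (by norm_num), padicValRat.of_int, h0, h4]
    norm_num
  -- odd: transported from `E₀(u)`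
  have hodd : TwoTorsionOdd W x := by
    have h' : TwoTorsionOdd (C • W) (C.toX x) := by
      rw [hC, h4]; exact twoTorsionOdd_neumannSetzerCurve₀ u
    exact (twoTorsionOdd_smul_iff W C x).mp h'
  rintro (⟨-, hnodd⟩ | ⟨-, hnram⟩)
  · exact hnodd hodd
  · exact hnram hram

/-- **At PRIME conductor `≠ 17` the Prop-5.14 habitat is empty** (modulo the named fact
`Setzer1975_primeConductor_rationalTwoTorsion`): a globally minimal `W/ℚ` of prime conductor `N ≠ 17` with a rational
point of order `2` with `x`-coordinate `x` never has «`⟨P⟩` ramified at `2` and not odd, or odd and not ramified at `2`».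
(At `N = 17` the same holds by inspection of 17a1–a4 — not asserted here.)
[cite: Setzer1975, pp. 367–378 (main theorem)] [cite: GreenbergLNM1716, Prop. 5.14 (chunk p0170)] -/
theorem not_prop514_of_prime_conductor (hS : Setzer1975_primeConductor_rationalTwoTorsion)
    (hN : (W.conductorNorm ℤ).Prime) (h17 : W.conductorNorm ℤ ≠ 17) {x : ℚ} (hx : HasRationalTwoTorsionX W x) :
    ¬ ((TwoTorsionRamifiedAtTwo x ∧ ¬ TwoTorsionOdd W x) ∨ (TwoTorsionOdd W x ∧ ¬ TwoTorsionRamifiedAtTwo x)) := by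
  rcases hS W x hx hN with h | ⟨u, hu4, hNu, C, hC | hC⟩
  · exact absurd h h17
  · exact not_prop514_of_smul_eq_neumannSetzerCurve₀ W hN hNu hu4 C hC hx
  · exact not_prop514_of_smul_eq_neumannSetzerCurve₁ W hN hNu hu4 C hC hx

end Habitat

/-! ## §5 The reduction of (★-SymbC) to non-prime level (and `17`) -/

/-- **(★-SymbC) reduces to conductors that are not prime (or equal to `17`).** For ANY conclusion `Concl W x`, a
statement with the binders and hypotheses of the registered `StarSymbC` (`W` globally minimal elliptic, good
ordinary at `2`, a UNIQUE rational `2`-torsion point with `x`-coordinate `x`, of type A xor B) follows from its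
restriction to `¬ (N_W prime) ∨ N_W = 17`, modulo Setzer's classification — because at prime conductor `≠ 17` the
hypotheses are contradictory (`not_prop514_of_prime_conductor`). The lead instantiates `Concl W x` with
`∀ N f, IsNewformOf W f → ∃ β, IsAdmissibleStabData N_W β ∧ SameOnCModTwo (plusCuspDiff f) (stabEisCuspDiff N_W β)`.
[cite: Setzer1975, pp. 367–378 (main theorem)] [cite: GreenbergLNM1716, Prop. 5.14 (chunk p0170)] -/
theorem of_restrict_offPrime (hS : Setzer1975_primeConductor_rationalTwoTorsion)
    {Concl : WeierstrassCurve ℚ → ℚ → Prop}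
    (hres : ∀ (W : WeierstrassCurve ℚ) [W.IsElliptic] [W.IsGloballyMinimal] (x : ℚ),
      (¬ (W.conductorNorm ℤ).Prime ∨ W.conductorNorm ℤ = 17) → IsOrdinaryAt W 2 →
      HasUniqueRationalTwoTorsionX W x →
      ((TwoTorsionRamifiedAtTwo x ∧ ¬ TwoTorsionOdd W x) ∨ (TwoTorsionOdd W x ∧ ¬ TwoTorsionRamifiedAtTwo x)) →
      Concl W x)
    (W : WeierstrassCurve ℚ) [W.IsElliptic] [W.IsGloballyMinimal] (x : ℚ) (hord : IsOrdinaryAt W 2)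
    (hx : HasUniqueRationalTwoTorsionX W x)
    (hAB : (TwoTorsionRamifiedAtTwo x ∧ ¬ TwoTorsionOdd W x) ∨ (TwoTorsionOdd W x ∧ ¬ TwoTorsionRamifiedAtTwo x)) :
    Concl W x := by
  by_cases h : (W.conductorNorm ℤ).Prime ∧ W.conductorNorm ℤ ≠ 17
  · exact absurd hAB (not_prop514_of_prime_conductor W hS h.1 h.2 hx.1)
  · refine hres W x ?_ hord hx hAB
    by_cases hp : (W.conductorNorm ℤ).Prime
    · right; by_contra h17; exact h ⟨hp, h17⟩
    · left; exact hp

/-- **(★-SymbC) HOLDS at every prime conductor `≠ 17`** (vacuously, modulo Setzer): the shape of the registered stub with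
the extra hypothesis `N_W` prime, `N_W ≠ 17`, for any conclusion. [cite: Setzer1975, pp. 367–378 (main theorem)]
[cite: GreenbergLNM1716, Prop. 5.14 (chunk p0170)] -/
theorem starSymbC_shape_of_prime_conductor (hS : Setzer1975_primeConductor_rationalTwoTorsion)
    {Concl : WeierstrassCurve ℚ → ℚ → Prop}
    (W : WeierstrassCurve ℚ) [W.IsElliptic] [W.IsGloballyMinimal] (x : ℚ)
    (hN : (W.conductorNorm ℤ).Prime) (h17 : W.conductorNorm ℤ ≠ 17)
    (hx : HasUniqueRationalTwoTorsionX W x)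
    (hAB : (TwoTorsionRamifiedAtTwo x ∧ ¬ TwoTorsionOdd W x) ∨ (TwoTorsionOdd W x ∧ ¬ TwoTorsionRamifiedAtTwo x)) :
    Concl W x :=
  absurd hAB (not_prop514_of_prime_conductor W hS hN h17 hx.1)

end Summit.BirchSwinnertonDyer.BirchSwinnertonDyer.Theorems.DepletionAtTwo

end
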